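import Mathlib

/-! # Stub `stub_eulerLeibnizAppend` — crux `TwoProducts` (stmt-ValiantsHypothesis-5906), line `corner-log-linearization`

Euler–Leibniz in partial-fraction form (pure algebra).  Write `θ f = Σ_{i : Fin 2} X_i · ∂_i f` for the Euler
operator on `ℂ[X₀, X₁]`.  Each `∂_i = MvPolynomial.pderiv i` is a derivation, so `θ (f g) = θ f · g + f · θ g`
and, by induction on the finset, `θ (∏_{k ∈ s} u_k) = Σ_{k ∈ s} θ(u_k) · ∏_{j ∈ s ∖ {k}} u_j`.  Hence
`θ(∏ u) · ∏ v − ∏ u · θ(∏ v)` is the partial-fraction numerator `Σ_{j : Fin (n+n)} p_j ∏_{i ≠ j} q_i` of the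
appended family `q = Fin.append u v`, `p = Fin.append (θ ∘ u) (−θ ∘ v)`: split the sum over `Fin (n + n)` with
`Fin.sum_univ_add` and compute the two erased products of the appended family
(`∏_{i ≠ castAdd n k} q_i = (∏_{i ≠ k} u_i) · ∏ v`, `∏_{i ≠ natAdd n k} q_i = ∏ u · ∏_{i ≠ k} v_i`).
The Euler operator is kept inlined as `∑ i : Fin 2, X i * pderiv i _` throughout (no auxiliary definition). [folklore] -/

set_option linter.dupNamespace false -- single-conjunct summit: `ValiantsHypothesis.ValiantsHypothesis`

namespace Summit.ValiantsHypothesis.ValiantsHypothesis.Theorems.TwoProducts.EulerLeibnizAppend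

open scoped BigOperators Classical
open MvPolynomial

noncomputable section

/-! ### The Euler operator `θ = X₀ ∂₀ + X₁ ∂₁` is a derivation -/

/-- Leibniz rule for the Euler operator `θ f = Σ_{i : Fin 2} X_i · ∂_i f`: `θ (f g) = θ f · g + f · θ g`.
[folklore] -/
theorem euler_mul (f g : MvPolynomial (Fin 2) ℂ) :
    (∑ i : Fin 2, X i * pderiv i (f * g)) =
      (∑ i : Fin 2, X i * pderiv i f) * g + f * ∑ i : Fin 2, X i * pderiv i g := by
  simp only [Fin.sum_univ_two, Derivation.leibniz, smul_eq_mul]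
  ring

/-- Leibniz rule for the Euler operator over a finite product:
`θ (∏_{k ∈ s} u_k) = Σ_{k ∈ s} θ(u_k) · ∏_{j ∈ s ∖ {k}} u_j`. [folklore] -/
theorem euler_finset_prod {ι : Type*} [DecidableEq ι] (s : Finset ι) (u : ι → MvPolynomial (Fin 2) ℂ) :
    (∑ i : Fin 2, X i * pderiv i (∏ k ∈ s, u k)) =
      ∑ k ∈ s, (∑ i : Fin 2, X i * pderiv i (u k)) * ∏ j ∈ s.erase k, u j := by
  induction s using Finset.induction_on with
  | empty => simp
  | insert a s ha ih =>
    rw [Finset.prod_insert ha, euler_mul, ih, Finset.sum_insert ha, Finset.erase_insert ha,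
      Finset.mul_sum]
    congr 1
    refine Finset.sum_congr rfl fun k hk => ?_
    rw [Finset.erase_insert_of_ne (ne_of_mem_of_not_mem hk ha).symm,
      Finset.prod_insert fun h => ha (Finset.mem_of_mem_erase h)]
    ring

/-! ### Erased products of an appended family -/

/-- A product over `univ ∖ {j}` is the full product of the family updated to `1` at `j`. [folklore] -/
theorem prod_univ_erase_eq_prod_update {ι M : Type*} [Fintype ι] [DecidableEq ι] [CommMonoid M]
    (f : ι → M) (j : ι) : ∏ i ∈ Finset.univ.erase j, f i = ∏ i, Function.update f j 1 i := by
  rw [← Finset.prod_erase Finset.univ (Function.update_self j (1 : M) f)]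
  exact Finset.prod_congr rfl fun i hi => by rw [Function.update_of_ne (Finset.ne_of_mem_erase hi)]

/-- Erasing a left index from an appended family:
`∏_{i ≠ castAdd n k} (u ++ v)_i = (∏_{i ≠ k} u_i) · ∏ v`. [folklore] -/
theorem prod_erase_castAdd {M : Type*} [CommMonoid M] {m n : ℕ} (u : Fin m → M) (v : Fin n → M)
    (k : Fin m) : ∏ i ∈ Finset.univ.erase (Fin.castAdd n k), Fin.append u v i =
      (∏ i ∈ Finset.univ.erase k, u i) * ∏ i, v i := by
  rw [prod_univ_erase_eq_prod_update, Fin.prod_univ_add, prod_univ_erase_eq_prod_update]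
  congr 1
  · refine Fintype.prod_congr _ _ fun i => ?_
    by_cases h : i = k
    · subst h
      simp
    · rw [Function.update_of_ne fun h' => h (Fin.castAdd_injective _ _ h'), Function.update_of_ne h,
        Fin.append_left]
  · refine Fintype.prod_congr _ _ fun i => ?_
    rw [Function.update_of_ne fun h' => ?_, Fin.append_right]
    have h1 := Fin.castAdd_lt n k
    have h2 := Fin.le_coe_natAdd m i
    have h3 := congrArg Fin.val h'
    omega

/-- Erasing a right index from an appended family:
`∏_{i ≠ natAdd m k} (u ++ v)_i = ∏ u · ∏_{i ≠ k} v_i`. [folklore] -/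
theorem prod_erase_natAdd {M : Type*} [CommMonoid M] {m n : ℕ} (u : Fin m → M) (v : Fin n → M)
    (k : Fin n) : ∏ i ∈ Finset.univ.erase (Fin.natAdd m k), Fin.append u v i =
      (∏ i, u i) * ∏ i ∈ Finset.univ.erase k, v i := by
  rw [prod_univ_erase_eq_prod_update, Fin.prod_univ_add, prod_univ_erase_eq_prod_update]
  congr 1
  · refine Fintype.prod_congr _ _ fun i => ?_
    rw [Function.update_of_ne fun h' => ?_, Fin.append_left]
    have h1 := Fin.castAdd_lt n i
    have h2 := Fin.le_coe_natAdd m k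
    have h3 := congrArg Fin.val h'
    omega
  · refine Fintype.prod_congr _ _ fun i => ?_
    by_cases h : i = k
    · subst h
      simp
    · rw [Function.update_of_ne fun h' => h (Fin.natAdd_injective _ _ h'), Function.update_of_ne h,
        Fin.append_right]

/-! ### The stub -/

/-- STUB 8b — EULER–LEIBNIZ IN PARTIAL-FRACTION FORM.  With `θ f = Σ_i X_i ∂_i f` the Euler operator,
`θ(∏ u) · ∏ v − ∏ u · θ(∏ v)` is the partial-fraction numerator `Σ_{j : Fin (n+n)} p_j ∏_{i ≠ j} q_i` of the
appended family `q = Fin.append u v`, `p = Fin.append (θ ∘ u) (−θ ∘ v)`. [folklore] -/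
theorem stub_eulerLeibnizAppend : ∀ (n : ℕ) (u v : Fin n → MvPolynomial (Fin 2) ℂ),
    (∑ i : Fin 2, MvPolynomial.X i * MvPolynomial.pderiv i (∏ k, u k)) * (∏ k, v k) -
        (∏ k, u k) * (∑ i : Fin 2, MvPolynomial.X i * MvPolynomial.pderiv i (∏ k, v k)) =
      ∑ j : Fin (n + n),
        Fin.append (fun k => ∑ i : Fin 2, MvPolynomial.X i * MvPolynomial.pderiv i (u k))
            (fun k => -(∑ i : Fin 2, MvPolynomial.X i * MvPolynomial.pderiv i (v k))) j *
          ∏ i ∈ Finset.univ.erase j, Fin.append u v i := by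
  intro n u v
  rw [Fin.sum_univ_add]
  simp only [Fin.append_left, Fin.append_right, prod_erase_castAdd, prod_erase_natAdd]
  rw [euler_finset_prod, euler_finset_prod, Finset.sum_mul, Finset.mul_sum, sub_eq_add_neg,
    ← Finset.sum_neg_distrib]
  congr 1
  · exact Finset.sum_congr rfl fun k _ => by ring
  · exact Finset.sum_congr rfl fun k _ => by ring

end

end Summit.ValiantsHypothesis.ValiantsHypothesis.Theorems.TwoProducts.EulerLeibnizAppend
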